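import Literature.Probability.LatticeModels.SixVertexTwoPointMeasure

/-!
# Six-vertex model: Theorem 23, Step 2 — pairs with a vertical displacement
# (DKLM 2026, proof of Theorem 23, Step 2: the path `u₁ → u₁ - ne₁ → u₁' - ne₁ → u₁'`,
# translation invariance, path independence and clustering)

H. Duminil-Copin, K. K. Kozlowski, P. Lammers, I. Manolescu, *Gaussian free field convergence of
the six-vertex model with `-1 ≤ Δ ≤ -1/2`*, arXiv:2603.06268 (2026) [DKLM2026SixVertexGFF]
(`paper:arxiv-2603.06268`, chunk p0044):

> **Step 2.** […] Fix `u` such that `y₁ ≠ 0` and `y₂ = 0`. […] we write the height difference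
> `h(u₁') - h(u₁)` as a sum of increments along the path `(u₁, u₁ - ne₁, u₁' - ne₁, u₁')`, with
> `e₁ = (1,0)`. The first and third steps are covered by Step 1, thus giving
> `Φ(u) - Φ(u₁-ne₁, u₁'-ne₁, u₂, u₂') = ∫ ((1-a)^{x₂}-1)(1-a)^{x₁'}e^{-iby₁'}(1-(1-a)^{x₁}e^{-iby₁})(1-(1-a)^n) dμ_L`.
> Now let `n` tend to infinity. […] It suffices to prove that […] the error term vanishes: […]
> this expectation may be written as `v_0† 𝔒₂ T(π/2)^n 𝔒₁ v_0` […] this tends to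
> `v_0† 𝔒₂ v_0 v_0† 𝔒₁ v_0` […] But `v_0† 𝔒₁ v_0 = v_0† 𝔒₂ v_0 = 0` as each factor encodes the
> expectation of a single height difference, which is zero by global flip symmetry.

For `a = b = 1`, `c > 0`, `L = 2(ℓ+1)`, in the anchored strip language of
`SixVertexTwoPointMeasure.lean` (pair 1 on a strip of `r₁'+1` columns, pair 2 after a gap `k`):

1. `colObs r' s q y₀` — the vertical height difference `h(face s+1, y₀+q) - h(face s+1, y₀)`
   (`+E` per north step across the east edges of column `s`, Def. 2.3), and the **L-shaped pair
   observable** `lPairObs = rowBlockObs + colObs` (`h(u₁') - h(u₁)` for `u₁' = u₁ + (x₁, q)`: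
   east along the row of `u₁`, then north).
2. **Flip-odd observables have zero cylinder expectation** (`IsFlipOdd`,
   `cylinderObsExp_eq_zero_of_isFlipOdd`; row blocks, columns and the L-observable are flip-odd).
3. **Translation** (`cylinderPairExp_lPairObs_shift`: the L-observable moved `n` columns to the
   right inside a wider strip has the same correlations), **restriction** (`cylinderPairExp_widen`:
   an observable read on the first columns of a wider strip, the extra columns joining the gap) and
   the **ice-rule path deformation** `torusObs_lPairObs_shift_eq_of_ice` (`X↑n = -A + M + C` on ice
   configurations: `A` = the row block of the first `n` columns, `M` = the un-shifted L-observable,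
   `C` = the row block of `n` columns on the upper row; `rect_path_independence`).
4. **Theorem 23, Step 2** (`cylinderPairExp_lPairObs_eq_sum`): for pair 1 with vertical
   displacement `q` and pair 2 horizontal,
   `Φ = ∑_k w_k ((1-a_k)^{x₂}-1)(1-a_k)^{x₁'} ω̄_k^{y₂} (ω_k^{y₀+q} - (1-a_k)^{x₁} ω_k^{y₀})`,
   the printed `∫ ((1-a)^{x₂}e^{-iby₂}-1)(1-a)^{x₁'}e^{-iby₁'}(1-(1-a)^{x₁}e^{-iby₁}) dμ_L` with
   `y₂ = 0`, `y₁ = q`, `e^{-iby₁'} = ω^{y(u₁')} ω̄^{y(u₂)}`, `e^{-iby₁} = ω̄^{q}` (`|ω| = 1`).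

## References

* H. Duminil-Copin, K. K. Kozlowski, P. Lammers, I. Manolescu, arXiv:2603.06268 (2026), proof of
  Theorem 23, Step 2. [DKLM2026SixVertexGFF]
-/

noncomputable section

open Finset Matrix Filter Topology
open Literature.LinearAlgebra.Matrix

namespace Literature.Probability.LatticeModels.SixVertex

/-! ## 1. Vertical differences and the L-shaped pair observable -/

section Obs

variable {G₂ : Type*} [AddCommGroup G₂] [One G₂] [Fintype G₂] [DecidableEq G₂]

/-- **A vertical height difference inside a strip**: `h(face s+1, y₀ + q) - h(face s+1, y₀) =
∑_{m < q} E(column s, row y₀ + m + 1)` — each unit step north across the east edge of the vertex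
`(s, y₀+m+1)` changes the height by `+1` if that arrow points east (Def. 2.3).
[cite: DKLM2026SixVertexGFF, Def. 2.3] -/
def colObs (r' : ℕ) (s : Fin (r' + 1)) (q : ℕ) (y₀ : G₂) :
    (G₂ → Bool) → (Fin (r' + 1) → G₂ → Bool) → (Fin (r' + 1) → G₂ → Bool) → ℝ :=
  fun _ κ _ => ∑ m ∈ Finset.range q, arrowSign (κ s (y₀ + (m + 1) • (1 : G₂)))

/-- **The L-shaped pair observable `h(u₁') - h(u₁)`** for `u₁ = (face a, y₀)`,
`u₁' = (face a + w' + 1, y₀ + q)`: east along the row `y₀` over the columns `a, …, a + w'`, then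
north `q` steps across the east edges of the column `a + w'`.
[cite: DKLM2026SixVertexGFF, Def. 2.3 and proof of Theorem 23, Step 2] -/
def lPairObs (r' a w' : ℕ) (h : a + w' + 1 ≤ r' + 1) (q : ℕ) (y₀ : G₂) :
    (G₂ → Bool) → (Fin (r' + 1) → G₂ → Bool) → (Fin (r' + 1) → G₂ → Bool) → ℝ :=
  rowBlockObs r' a w' h y₀ + colObs r' ⟨a + w', by omega⟩ q y₀

omit [Fintype G₂] [DecidableEq G₂] in
/-- The torus reading of a vertical difference. [folklore] -/
theorem torusObs_colObs {M : ℕ} (r' : ℕ) (s : Fin (r' + 1)) (q : ℕ) (y₀ : G₂) (ω : Config (ZMod M × G₂)) :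
    torusObs r' (colObs r' s q y₀) ω =
      ∑ m ∈ Finset.range q, arrowSign ((ω (((s : ℕ) : ZMod M), y₀ + (m + 1) • (1 : G₂))).1) := rfl

omit [Fintype G₂] [DecidableEq G₂] in
/-- The torus reading of the L-observable. [folklore] -/
theorem torusObs_lPairObs {M : ℕ} (r' a w' : ℕ) (h : a + w' + 1 ≤ r' + 1) (q : ℕ) (y₀ : G₂)
    (ω : Config (ZMod M × G₂)) :
    torusObs r' (lPairObs r' a w' h q y₀) ω =
      (-∑ i : Fin (w' + 1), arrowSign ((ω (((a + (i : ℕ) : ℕ) : ZMod M), y₀)).2)) +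
        ∑ m ∈ Finset.range q, arrowSign ((ω (((a + w' : ℕ) : ZMod M), y₀ + (m + 1) • (1 : G₂))).1) := rfl

/-! ## 2. Flip-odd observables -/

/-- A strip observable is **flip-odd** if reversing all arrows changes its sign.
[cite: DKLM2026SixVertexGFF, §2.1 (global arrow flip) and Lemma 61] -/
def IsFlipOdd {r' : ℕ} (X : (G₂ → Bool) → (Fin (r' + 1) → G₂ → Bool) → (Fin (r' + 1) → G₂ → Bool) → ℝ) :
    Prop :=
  ∀ i κ α, X (fun y => !i y) (fun k y => !κ k y) (fun k y => !α k y) = -X i κ α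

omit [AddCommGroup G₂] [One G₂] [Fintype G₂] [DecidableEq G₂] in
/-- Reading a flipped configuration feeds the observable the flipped arguments. [folklore] -/
theorem torusObs_flip {M : ℕ} {r' : ℕ}
    (X : (G₂ → Bool) → (Fin (r' + 1) → G₂ → Bool) → (Fin (r' + 1) → G₂ → Bool) → ℝ)
    (ω : Config (ZMod M × G₂)) :
    torusObs r' X (fun w => (!(ω w).1, !(ω w).2)) =
      X (fun y => !(ω (-1, y)).1) (fun k y => !(ω (((k : ℕ) : ZMod M), y)).1)
        (fun k y => !(ω (((k : ℕ) : ZMod M), y)).2) := rfl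

/-- **Flip-odd observables have `𝔼_{𝕋}[X | balanced] = 0`.** [cite: DKLM2026SixVertexGFF, Lemma 61 (proof)] -/
theorem torusObsExp_eq_zero_of_isFlipOdd (c : ℝ) (M : ℕ) {r' : ℕ}
    {X : (G₂ → Bool) → (Fin (r' + 1) → G₂ → Bool) → (Fin (r' + 1) → G₂ → Bool) → ℝ}
    (hX : IsFlipOdd X) : torusObsExp c M r' X = 0 := by
  unfold torusObsExp
  split_ifs with hM
  · rfl
  · haveI : NeZero M := ⟨hM⟩
    refine torusCondExp_eq_zero_of_flip_odd 1 1 c _ fun ω => ?_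
    rw [torusObs_flip]
    exact hX _ _ _

/-- **Flip-odd observables have `𝔼_{CYL_L}[X] = 0`** (global flip symmetry).
[cite: DKLM2026SixVertexGFF, proof of Theorem 23, Step 2 ("zero by global flip symmetry")] -/
theorem cylinderObsExp_eq_zero_of_isFlipOdd (c : ℝ) {r' : ℕ}
    {X : (G₂ → Bool) → (Fin (r' + 1) → G₂ → Bool) → (Fin (r' + 1) → G₂ → Bool) → ℝ}
    (hX : IsFlipOdd X) : cylinderObsExp c r' X = 0 := by
  unfold cylinderObsExp
  have h : (fun M : ℕ => torusObsExp c M r' X) = fun _ => 0 :=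
    funext fun M => torusObsExp_eq_zero_of_isFlipOdd c M hX
  rw [h]
  exact tendsto_const_nhds.limUnder_eq

omit [AddCommGroup G₂] [One G₂] [Fintype G₂] [DecidableEq G₂] in
/-- Row blocks are flip-odd. [folklore] -/
theorem isFlipOdd_rowBlockObs (r' a w' : ℕ) (h : a + w' + 1 ≤ r' + 1) (y : G₂) :
    IsFlipOdd (rowBlockObs r' a w' h y) := by
  intro i κ α
  simp only [rowBlockObs, arrowSign_not, Finset.sum_neg_distrib, neg_neg]

omit [Fintype G₂] [DecidableEq G₂] in
/-- Vertical differences are flip-odd. [folklore] -/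
theorem isFlipOdd_colObs (r' : ℕ) (s : Fin (r' + 1)) (q : ℕ) (y₀ : G₂) : IsFlipOdd (colObs r' s q y₀) := by
  intro i κ α
  simp only [colObs, arrowSign_not, Finset.sum_neg_distrib]

omit [Fintype G₂] [DecidableEq G₂] in
/-- The L-observable is flip-odd (a single height difference). [cite: DKLM2026SixVertexGFF, proof of Theorem 23, Step 2] -/
theorem isFlipOdd_lPairObs (r' a w' : ℕ) (h : a + w' + 1 ≤ r' + 1) (q : ℕ) (y₀ : G₂) :
    IsFlipOdd (lPairObs r' a w' h q y₀) := by
  intro i κ α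
  have h1 := isFlipOdd_rowBlockObs r' a w' h y₀ i κ α
  have h2 := isFlipOdd_colObs r' ⟨a + w', by omega⟩ q y₀ i κ α
  simp only [lPairObs, Pi.add_apply] at h1 h2 ⊢
  rw [h1, h2, neg_add]

/-! ## 3. Translation, restriction and the ice-rule path deformation -/

omit [AddCommGroup G₂] [One G₂] [Fintype G₂] [DecidableEq G₂] in
/-- A block sum over `Fin (w'+1)` as a `range` sum. [folklore] -/
theorem sum_fin_block {M : ℕ} (ω : Config (ZMod M × G₂)) (b w' : ℕ) (y : G₂) :
    ∑ i : Fin (w' + 1), arrowSign ((ω (((b + (i : ℕ) : ℕ) : ZMod M), y)).2) =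
      ∑ s ∈ Finset.range (w' + 1), arrowSign ((ω (((b + s : ℕ) : ZMod M), y)).2) :=
  Fin.sum_univ_eq_sum_range (fun s => arrowSign ((ω (((b + s : ℕ) : ZMod M), y)).2)) (w' + 1)

/-- Splitting a sum of consecutive columns at two places. [folklore] -/
theorem sum_range_split_two (f : ℕ → ℝ) (a n' w' : ℕ) :
    (∑ s ∈ Finset.range (n' + 1), f (a + s)) + ∑ s ∈ Finset.range (w' + 1), f (a + n' + 1 + s) =
      (∑ s ∈ Finset.range (w' + 1), f (a + s)) + ∑ s ∈ Finset.range (n' + 1), f (a + w' + 1 + s) := by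
  have h1 : (∑ s ∈ Finset.range (n' + 1), f (a + s)) + ∑ s ∈ Finset.range (w' + 1), f (a + n' + 1 + s) =
      ∑ s ∈ Finset.range (n' + 1 + (w' + 1)), f (a + s) := by
    rw [Finset.sum_range_add (fun s => f (a + s)) (n' + 1) (w' + 1)]
    congr 1
    refine Finset.sum_congr rfl fun s _ => ?_
    congr 1
    omega
  have h2 : (∑ s ∈ Finset.range (w' + 1), f (a + s)) + ∑ s ∈ Finset.range (n' + 1), f (a + w' + 1 + s) =
      ∑ s ∈ Finset.range (w' + 1 + (n' + 1)), f (a + s) := by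
    rw [Finset.sum_range_add (fun s => f (a + s)) (w' + 1) (n' + 1)]
    congr 1
    refine Finset.sum_congr rfl fun s _ => ?_
    congr 1
    omega
  rw [h1, h2, show n' + 1 + (w' + 1) = w' + 1 + (n' + 1) by omega]

omit [Fintype G₂] [DecidableEq G₂] in
/-- **The ice-rule path deformation** (Step 2: the path `u₁ → u₁-ne₁ → u₁'-ne₁ → u₁'`): on every
ice configuration of the torus, the L-observable with block start `a + n'+1` equals
`-A + M + C` with `A` the row block of the `n'+1` columns `a, …, a+n'` on the row `y₀`, `M` the
L-observable with block start `a`, and `C` the row block of the `n'+1` columns `a+w'+1, …` on the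
upper row `y₀ + q`. [cite: DKLM2026SixVertexGFF, proof of Theorem 23, Step 2, with Def. 2.3 / §4.5.1] -/
theorem torusObs_lPairObs_shift_eq_of_ice {M : ℕ} (r' a w' n' : ℕ) (h : a + w' + 1 ≤ r' + 1) (q : ℕ) (y₀ : G₂)
    (ω : Config (ZMod M × G₂)) (hice : ∀ v, IceRuleAt ω v) :
    torusObs (r' + (n' + 1)) (lPairObs (r' + (n' + 1)) (a + (n' + 1)) w' (by omega) q y₀) ω =
      -torusObs (r' + (n' + 1)) (rowBlockObs (r' + (n' + 1)) a n' (by omega) y₀) ω +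
        torusObs (r' + (n' + 1)) (lPairObs (r' + (n' + 1)) a w' (by omega) q y₀) ω +
        torusObs (r' + (n' + 1)) (rowBlockObs (r' + (n' + 1)) (a + w' + 1) n' (by omega) (y₀ + q • (1 : G₂))) ω := by
  rw [torusObs_lPairObs, torusObs_lPairObs, torusObs_rowBlockObs, torusObs_rowBlockObs]
  -- the rectangle over the columns `a+w'+1, …, a+w'+n'+1` between the rows `y₀` and `y₀ + q`
  have hrect := rect_path_independence ω (((a + w' : ℕ)) : ZMod M) y₀ (n' + 1) q
    (fun s m _ _ => hice _)
  simp only [sum_fin_block]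
  have e1 : ∀ s : ℕ, (((a + w' : ℕ)) : ZMod M) + (s + 1) • (1 : ZMod M) = (((a + w' + 1 + s : ℕ)) : ZMod M) := by
    intro s; rw [nsmul_one]; push_cast; ring
  have e2 : (a + w' + 1 + n' : ℕ) = a + n' + 1 + w' := by omega
  simp only [e1, e2, Finset.sum_neg_distrib] at hrect
  have hsplit := sum_range_split_two (fun s => arrowSign ((ω (((s : ℕ) : ZMod M), y₀)).2)) a n' w'
  have e3 : ∀ s : ℕ, a + (n' + 1) + s = a + n' + 1 + s := fun s => by omega
  simp only [e3]
  linarith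

/-- Equal torus pair expectations for all `M` give equal cylinder pair expectations. [folklore] -/
theorem cylinderPairExp_congr {r₁' r₂' s₁' s₂' : ℕ}
    {X : (G₂ → Bool) → (Fin (r₁' + 1) → G₂ → Bool) → (Fin (r₁' + 1) → G₂ → Bool) → ℝ} {n : ℕ}
    {Y : (G₂ → Bool) → (Fin (r₂' + 1) → G₂ → Bool) → (Fin (r₂' + 1) → G₂ → Bool) → ℝ}
    {X' : (G₂ → Bool) → (Fin (s₁' + 1) → G₂ → Bool) → (Fin (s₁' + 1) → G₂ → Bool) → ℝ} {n' : ℕ}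
    {Y' : (G₂ → Bool) → (Fin (s₂' + 1) → G₂ → Bool) → (Fin (s₂' + 1) → G₂ → Bool) → ℝ} (c : ℝ)
    (h : ∀ M, torusPairExp c M r₁' X n r₂' Y = torusPairExp c M s₁' X' n' s₂' Y') :
    cylinderPairExp c r₁' X n r₂' Y = cylinderPairExp c s₁' X' n' s₂' Y' := by
  unfold cylinderPairExp
  rw [funext h]

/-- **Restriction / widening**: the L-observable read on the first columns of a strip widened by
`n` columns on the right has the same pair correlations, the extra columns joining the gap:
`𝔼[X^{(wide)} · τ_k Y] = 𝔼[X · τ_{n+k} Y]`. [folklore] -/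
theorem cylinderPairExp_widen (c : ℝ) {r₁' r₂' : ℕ} (a w' : ℕ) (h : a + w' + 1 ≤ r₁' + 1) (q : ℕ) (y₀ : G₂)
    (n k : ℕ) (Y : (G₂ → Bool) → (Fin (r₂' + 1) → G₂ → Bool) → (Fin (r₂' + 1) → G₂ → Bool) → ℝ) :
    cylinderPairExp c (r₁' + n) (lPairObs (r₁' + n) a w' (by omega) q y₀) (r₁' + n + 1 + k) r₂' Y =
      cylinderPairExp c r₁' (lPairObs r₁' a w' h q y₀) (r₁' + 1 + (n + k)) r₂' Y := by
  rw [show r₁' + n + 1 + k = r₁' + 1 + (n + k) by omega]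
  exact cylinderPairExp_congr c fun M => rfl

omit [One G₂] [Fintype G₂] [DecidableEq G₂] in
/-- The row block read at columns `a₀ + n, …` of a widened strip is the block at `a₀, …` of the
original strip shifted by `n`. [folklore] -/
theorem torusPairObs_rowBlockObs_shift {M : ℕ} {r₁' r₂' : ℕ} (a₀ w' : ℕ) (h : a₀ + w' + 1 ≤ r₁' + 1) (y : G₂)
    (n k : ℕ) (Y : (G₂ → Bool) → (Fin (r₂' + 1) → G₂ → Bool) → (Fin (r₂' + 1) → G₂ → Bool) → ℝ)
    (ω : Config (ZMod M × G₂)) :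
    torusPairObs (r₁' + n) (rowBlockObs (r₁' + n) (a₀ + n) w' (by omega) y) (r₁' + n + 1 + k) r₂' Y ω =
      torusPairObs r₁' (rowBlockObs r₁' a₀ w' h y) (r₁' + 1 + k) r₂' Y
        (fun w => ω (w + (((n : ℕ) : ZMod M), 0))) := by
  have hY : (fun v : ZMod M × G₂ => ω (v + ((((r₁' + n + 1 + k : ℕ)) : ZMod M), 0))) =
      fun v => ω (v + ((((r₁' + 1 + k : ℕ)) : ZMod M), 0) + (((n : ℕ) : ZMod M), 0)) := by
    funext v
    simp only [Prod.mk_add_mk, add_zero, add_assoc]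
    congr 2
    push_cast
    ring
  unfold torusPairObs
  rw [torusObs_rowBlockObs, torusObs_rowBlockObs, hY]
  congr 2
  refine Finset.sum_congr rfl fun i _ => ?_
  simp only [Prod.mk_add_mk, add_zero]
  congr 3
  push_cast
  ring

omit [Fintype G₂] [DecidableEq G₂] in
/-- The L-observable read at block start `a₀ + n` of a widened strip is the original one shifted
by `n`. [folklore] -/
theorem torusPairObs_lPairObs_shift {M : ℕ} {r₁' r₂' : ℕ} (a₀ w' : ℕ) (h : a₀ + w' + 1 ≤ r₁' + 1) (q : ℕ)
    (y₀ : G₂) (n k : ℕ) (Y : (G₂ → Bool) → (Fin (r₂' + 1) → G₂ → Bool) → (Fin (r₂' + 1) → G₂ → Bool) → ℝ)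
    (ω : Config (ZMod M × G₂)) :
    torusPairObs (r₁' + n) (lPairObs (r₁' + n) (a₀ + n) w' (by omega) q y₀) (r₁' + n + 1 + k) r₂' Y ω =
      torusPairObs r₁' (lPairObs r₁' a₀ w' h q y₀) (r₁' + 1 + k) r₂' Y
        (fun w => ω (w + (((n : ℕ) : ZMod M), 0))) := by
  have hY : (fun v : ZMod M × G₂ => ω (v + ((((r₁' + n + 1 + k : ℕ)) : ZMod M), 0))) =
      fun v => ω (v + ((((r₁' + 1 + k : ℕ)) : ZMod M), 0) + (((n : ℕ) : ZMod M), 0)) := by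
    funext v
    simp only [Prod.mk_add_mk, add_zero, add_assoc]
    congr 2
    push_cast
    ring
  unfold torusPairObs
  rw [torusObs_lPairObs, torusObs_lPairObs, hY]
  simp only [Prod.mk_add_mk, add_zero]
  congr 2
  · congr 1
    refine Finset.sum_congr rfl fun i _ => ?_
    congr 3
    push_cast
    ring
  · refine Finset.sum_congr rfl fun m _ => ?_
    congr 3
    push_cast
    ring

/-- **Translation invariance**: the L-observable moved `n` columns to the right inside a widened
strip has the same pair correlations: `𝔼[X↑n · τ_k Y] = 𝔼[X · τ_k Y]`.
[cite: DKLM2026SixVertexGFF, Cor. 56 (5)] -/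
theorem cylinderPairExp_lPairObs_shift (c : ℝ) {r₁' r₂' : ℕ} (a₀ w' : ℕ) (h : a₀ + w' + 1 ≤ r₁' + 1) (q : ℕ)
    (y₀ : G₂) (n k : ℕ) (Y : (G₂ → Bool) → (Fin (r₂' + 1) → G₂ → Bool) → (Fin (r₂' + 1) → G₂ → Bool) → ℝ) :
    cylinderPairExp c (r₁' + n) (lPairObs (r₁' + n) (a₀ + n) w' (by omega) q y₀) (r₁' + n + 1 + k) r₂' Y =
      cylinderPairExp c r₁' (lPairObs r₁' a₀ w' h q y₀) (r₁' + 1 + k) r₂' Y := by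
  refine cylinderPairExp_congr c fun M => ?_
  unfold torusPairExp
  split_ifs with hM
  · rfl
  · haveI : NeZero M := ⟨hM⟩
    rw [funext fun ω => torusPairObs_lPairObs_shift a₀ w' h q y₀ n k Y ω]
    exact torusCondExp_comp_shift 1 1 c ((((n : ℕ) : ZMod M)), (0 : G₂)) _

/-- The same for row blocks. [cite: DKLM2026SixVertexGFF, Cor. 56 (5)] -/
theorem cylinderPairExp_rowBlockObs_shift (c : ℝ) {r₁' r₂' : ℕ} (a₀ w' : ℕ) (h : a₀ + w' + 1 ≤ r₁' + 1) (y : G₂)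
    (n k : ℕ) (Y : (G₂ → Bool) → (Fin (r₂' + 1) → G₂ → Bool) → (Fin (r₂' + 1) → G₂ → Bool) → ℝ) :
    cylinderPairExp c (r₁' + n) (rowBlockObs (r₁' + n) (a₀ + n) w' (by omega) y) (r₁' + n + 1 + k) r₂' Y =
      cylinderPairExp c r₁' (rowBlockObs r₁' a₀ w' h y) (r₁' + 1 + k) r₂' Y := by
  refine cylinderPairExp_congr c fun M => ?_
  unfold torusPairExp
  split_ifs with hM
  · rfl
  · haveI : NeZero M := ⟨hM⟩
    rw [funext fun ω => torusPairObs_rowBlockObs_shift a₀ w' h y n k Y ω]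
    exact torusCondExp_comp_shift 1 1 c ((((n : ℕ) : ZMod M)), (0 : G₂)) _

end Obs

/-! ## 4. Theorem 23, Step 2 -/

section StepTwo

variable (c : ℝ) (hc : 0 < c) (ℓ : ℕ)

include hc

/-- `(1 - a_k)^n → 0` off the top index, `→ 1` at the top index, against a weight vanishing at the
top: `w_k (1 - a_k)^n → 0`. [cite: DKLM2026SixVertexGFF, proof of Theorem 23, Step 2 ("since `μ_L` is a finite sum of Dirac measures with `0 < a < 2`")] -/
theorem tendsto_dklmWeight_mul_pow (k : {κ : ZMod (2 * (ℓ + 1)) → Bool // IsBalancedCol κ}) :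
    Tendsto (fun n : ℕ => (dklmWeight c hc ℓ k : ℂ) * (1 - (dklmAtomA c ℓ k : ℂ)) ^ n) atTop (𝓝 0) := by
  by_cases hk : k = topIdx c hc ℓ
  · have hw : dklmWeight c hc ℓ k = 0 := by unfold dklmWeight; rw [if_pos hk]
    simp [hw]
  · have ha := dklmAtomA_mem_Ioo c hc ℓ hk
    rw [show (0 : ℂ) = (dklmWeight c hc ℓ k : ℂ) * 0 by simp]
    refine Tendsto.const_mul _ (tendsto_pow_atTop_nhds_zero_of_norm_lt_one ?_)
    rw [show (1 : ℂ) - (dklmAtomA c ℓ k : ℂ) = ((1 - dklmAtomA c ℓ k : ℝ) : ℂ) by push_cast; ring,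
      Complex.norm_real, Real.norm_eq_abs, abs_lt]
    constructor <;> linarith [ha.1, ha.2]

/-- **Theorem 23, Step 2 (vertical displacement of the first pair).** For `c > 0`, `L = 2(ℓ+1)`,
pair 1 the L-shaped difference `h(u₁') - h(u₁)`, `u₁ = (face a₁, y₀)`, `u₁' = u₁ + (x₁, q)`,
`x₁ = w₁'+1`, and pair 2 the horizontal difference over `x₂ = w₂'+1` columns on the row `y₂` at
horizontal distance `x₁' = (r₁' - a₁ - w₁') + k + a₂`:
`Φ_{CYL_L,2}(u) = ∑_k w_k ((1-a_k)^{x₂} - 1)(1-a_k)^{x₁'} ω̄_k^{y₂} (ω_k^{y₀+q} - (1-a_k)^{x₁} ω_k^{y₀})`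
— the printed formula with `y₂ = 0`, `y₁ = q`, `e^{-iby₁'} = ω^{y(u₁')}ω̄^{y(u₂)}`, `e^{-iby₁} = ω̄^q`.
[cite: DKLM2026SixVertexGFF, Theorem 23 and its proof, Step 2] -/
theorem cylinderPairExp_lPairObs_eq_sum {r₁' r₂' : ℕ} (a₁ w₁' : ℕ) (h₁ : a₁ + w₁' + 1 ≤ r₁' + 1) (q : ℕ)
    (a₂ w₂' : ℕ) (h₂ : a₂ + w₂' + 1 ≤ r₂' + 1) (y₀ y₂ k : ℕ) :
    ((cylinderPairExp c r₁' (lPairObs r₁' a₁ w₁' h₁ q ((y₀ : ℕ) : ZMod (2 * (ℓ + 1)))) (r₁' + 1 + k) r₂'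
        (rowBlockObs r₂' a₂ w₂' h₂ ((y₂ : ℕ) : ZMod (2 * (ℓ + 1)))) : ℝ) : ℂ) =
      ∑ j, (dklmWeight c hc ℓ j : ℂ) * ((1 - (dklmAtomA c ℓ j : ℂ)) ^ (w₂' + 1) - 1) *
        (1 - (dklmAtomA c ℓ j : ℂ)) ^ ((r₁' - a₁ - w₁') + k + a₂) * star (transferJointPhase c ℓ j) ^ y₂ *
        (transferJointPhase c ℓ j ^ (y₀ + q) - (1 - (dklmAtomA c ℓ j : ℂ)) ^ (w₁' + 1) * transferJointPhase c ℓ j ^ y₀) := by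
  -- the three pieces for every `n = n' + 1`
  have hdecomp : ∀ n' : ℕ,
      cylinderPairExp c r₁' (lPairObs r₁' a₁ w₁' h₁ q ((y₀ : ℕ) : ZMod (2 * (ℓ + 1)))) (r₁' + 1 + k) r₂' (rowBlockObs r₂' a₂ w₂' h₂ ((y₂ : ℕ) : ZMod (2 * (ℓ + 1)))) =
        -cylinderPairExp c (r₁' + (n' + 1)) (rowBlockObs (r₁' + (n' + 1)) a₁ n' (by omega) ((y₀ : ℕ) : ZMod (2 * (ℓ + 1))))
            (r₁' + (n' + 1) + 1 + k) r₂' (rowBlockObs r₂' a₂ w₂' h₂ ((y₂ : ℕ) : ZMod (2 * (ℓ + 1)))) +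
          cylinderPairExp c r₁' (lPairObs r₁' a₁ w₁' h₁ q ((y₀ : ℕ) : ZMod (2 * (ℓ + 1)))) (r₁' + 1 + ((n' + 1) + k)) r₂' (rowBlockObs r₂' a₂ w₂' h₂ ((y₂ : ℕ) : ZMod (2 * (ℓ + 1)))) +
          cylinderPairExp c (r₁' + (n' + 1))
            (rowBlockObs (r₁' + (n' + 1)) (a₁ + w₁' + 1) n' (by omega) (((y₀ : ℕ) : ZMod (2 * (ℓ + 1))) + q • (1 : ZMod (2 * (ℓ + 1)))))
            (r₁' + (n' + 1) + 1 + k) r₂' (rowBlockObs r₂' a₂ w₂' h₂ ((y₂ : ℕ) : ZMod (2 * (ℓ + 1)))) := by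
    intro n'
    -- move `X` to the right by `n'+1`, deform the path on ice configurations, expand by bilinearity
    have hice : cylinderPairExp c (r₁' + (n' + 1))
        (lPairObs (r₁' + (n' + 1)) (a₁ + (n' + 1)) w₁' (by omega) q ((y₀ : ℕ) : ZMod (2 * (ℓ + 1))))
        (r₁' + (n' + 1) + 1 + k) r₂' (rowBlockObs r₂' a₂ w₂' h₂ ((y₂ : ℕ) : ZMod (2 * (ℓ + 1)))) =
        cylinderPairExp c (r₁' + (n' + 1))
          ((-1 : ℝ) • rowBlockObs (r₁' + (n' + 1)) a₁ n' (by omega) ((y₀ : ℕ) : ZMod (2 * (ℓ + 1))) +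
            lPairObs (r₁' + (n' + 1)) a₁ w₁' (by omega) q ((y₀ : ℕ) : ZMod (2 * (ℓ + 1))) +
            rowBlockObs (r₁' + (n' + 1)) (a₁ + w₁' + 1) n' (by omega)
              (((y₀ : ℕ) : ZMod (2 * (ℓ + 1))) + q • (1 : ZMod (2 * (ℓ + 1)))))
          (r₁' + (n' + 1) + 1 + k) r₂' (rowBlockObs r₂' a₂ w₂' h₂ ((y₂ : ℕ) : ZMod (2 * (ℓ + 1)))) := by
      refine cylinderPairExp_congr c fun M => ?_
      unfold torusPairExp
      split_ifs with hM
      · rfl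
      · haveI : NeZero M := ⟨hM⟩
        refine torusCondExp_congr_of_ice 1 1 c fun ω hω => ?_
        unfold torusPairObs
        congr 1
        rw [torusObs_lPairObs_shift_eq_of_ice r₁' a₁ w₁' n' h₁ q _ ω hω]
        show _ = (-1 : ℝ) * torusObs (r₁' + (n' + 1)) (rowBlockObs (r₁' + (n' + 1)) a₁ n' (by omega)
            ((y₀ : ℕ) : ZMod (2 * (ℓ + 1)))) ω +
          torusObs (r₁' + (n' + 1)) (lPairObs (r₁' + (n' + 1)) a₁ w₁' (by omega) q ((y₀ : ℕ) : ZMod (2 * (ℓ + 1)))) ω +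
          torusObs (r₁' + (n' + 1)) (rowBlockObs (r₁' + (n' + 1)) (a₁ + w₁' + 1) n' (by omega)
            (((y₀ : ℕ) : ZMod (2 * (ℓ + 1))) + q • (1 : ZMod (2 * (ℓ + 1))))) ω
        ring
    rw [← cylinderPairExp_lPairObs_shift c a₁ w₁' h₁ q ((y₀ : ℕ) : ZMod (2 * (ℓ + 1))) (n' + 1) k, hice,
      cylinderPairExp_add_left c hc, cylinderPairExp_add_left c hc, cylinderPairExp_smul_left c hc,
      cylinderPairExp_widen c a₁ w₁' h₁ q ((y₀ : ℕ) : ZMod (2 * (ℓ + 1))) (n' + 1) k]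
    ring
  -- limits of the three pieces as `n' → ∞`
  -- (a) the error term: clustering and flip symmetry
  have hM : Tendsto (fun n' : ℕ => cylinderPairExp c r₁' (lPairObs r₁' a₁ w₁' h₁ q ((y₀ : ℕ) : ZMod (2 * (ℓ + 1)))) (r₁' + 1 + ((n' + 1) + k)) r₂' (rowBlockObs r₂' a₂ w₂' h₂ ((y₂ : ℕ) : ZMod (2 * (ℓ + 1))))) atTop (𝓝 0) := by
    have h := (tendsto_cylinderPairExp_atTop c hc ℓ (lPairObs r₁' a₁ w₁' h₁ q ((y₀ : ℕ) : ZMod (2 * (ℓ + 1)))) (rowBlockObs r₂' a₂ w₂' h₂ ((y₂ : ℕ) : ZMod (2 * (ℓ + 1))))).comp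
      ((tendsto_add_atTop_nat k).comp (tendsto_add_atTop_nat 1))
    rw [cylinderObsExp_eq_zero_of_isFlipOdd c (isFlipOdd_lPairObs r₁' a₁ w₁' h₁ q _), zero_mul] at h
    exact h
  -- (b) the two row-block pieces, cast to `ℂ`, are explicit finite sums
  have hA : ∀ n' : ℕ, ((cylinderPairExp c (r₁' + (n' + 1)) (rowBlockObs (r₁' + (n' + 1)) a₁ n' (by omega) ((y₀ : ℕ) : ZMod (2 * (ℓ + 1))))
      (r₁' + (n' + 1) + 1 + k) r₂' (rowBlockObs r₂' a₂ w₂' h₂ ((y₂ : ℕ) : ZMod (2 * (ℓ + 1)))) : ℝ) : ℂ) =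
      ∑ j, (dklmWeight c hc ℓ j : ℂ) * ((1 - (dklmAtomA c ℓ j : ℂ)) ^ (w₂' + 1) - 1) *
        (1 - (dklmAtomA c ℓ j : ℂ)) ^ ((r₁' + (n' + 1) - a₁ - n') + k + a₂) * transferJointPhase c ℓ j ^ y₀ *
        star (transferJointPhase c ℓ j) ^ y₂ * (1 - (1 - (dklmAtomA c ℓ j : ℂ)) ^ (n' + 1)) := fun n' =>
    cylinderPairExp_rowBlockObs_eq_sum c hc ℓ a₁ n' (by omega) a₂ w₂' h₂ y₀ y₂ k
  have hC : ∀ n' : ℕ, ((cylinderPairExp c (r₁' + (n' + 1))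
      (rowBlockObs (r₁' + (n' + 1)) (a₁ + w₁' + 1) n' (by omega) (((y₀ : ℕ) : ZMod (2 * (ℓ + 1))) + q • (1 : ZMod (2 * (ℓ + 1)))))
      (r₁' + (n' + 1) + 1 + k) r₂' (rowBlockObs r₂' a₂ w₂' h₂ ((y₂ : ℕ) : ZMod (2 * (ℓ + 1)))) : ℝ) : ℂ) =
      ∑ j, (dklmWeight c hc ℓ j : ℂ) * ((1 - (dklmAtomA c ℓ j : ℂ)) ^ (w₂' + 1) - 1) *
        (1 - (dklmAtomA c ℓ j : ℂ)) ^ ((r₁' + (n' + 1) - (a₁ + w₁' + 1) - n') + k + a₂) *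
        transferJointPhase c ℓ j ^ (y₀ + q) * star (transferJointPhase c ℓ j) ^ y₂ *
        (1 - (1 - (dklmAtomA c ℓ j : ℂ)) ^ (n' + 1)) := by
    intro n'
    have h := cylinderPairExp_rowBlockObs_eq_sum c hc ℓ (r₁' := r₁' + (n' + 1)) (a₁ + w₁' + 1) n' (by omega) a₂ w₂' h₂ (y₀ + q) y₂ k
    rw [show (((y₀ + q : ℕ)) : ZMod (2 * (ℓ + 1))) = ((y₀ : ℕ) : ZMod (2 * (ℓ + 1))) + q • (1 : ZMod (2 * (ℓ + 1))) by rw [nsmul_one]; push_cast; ring] at h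
    exact h
  -- the constant sequence equals its limit
  have hconst : Tendsto (fun n' : ℕ => ((cylinderPairExp c r₁' (lPairObs r₁' a₁ w₁' h₁ q ((y₀ : ℕ) : ZMod (2 * (ℓ + 1)))) (r₁' + 1 + k) r₂' (rowBlockObs r₂' a₂ w₂' h₂ ((y₂ : ℕ) : ZMod (2 * (ℓ + 1)))) : ℝ) : ℂ)) atTop
      (𝓝 (∑ j, (dklmWeight c hc ℓ j : ℂ) * ((1 - (dklmAtomA c ℓ j : ℂ)) ^ (w₂' + 1) - 1) *
        (1 - (dklmAtomA c ℓ j : ℂ)) ^ ((r₁' - a₁ - w₁') + k + a₂) * star (transferJointPhase c ℓ j) ^ y₂ *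
        (transferJointPhase c ℓ j ^ (y₀ + q) - (1 - (dklmAtomA c ℓ j : ℂ)) ^ (w₁' + 1) * transferJointPhase c ℓ j ^ y₀))) := by
    have hseq : (fun n' : ℕ => ((cylinderPairExp c r₁' (lPairObs r₁' a₁ w₁' h₁ q ((y₀ : ℕ) : ZMod (2 * (ℓ + 1)))) (r₁' + 1 + k) r₂' (rowBlockObs r₂' a₂ w₂' h₂ ((y₂ : ℕ) : ZMod (2 * (ℓ + 1)))) : ℝ) : ℂ)) = fun n' : ℕ =>
        -(∑ j, (dklmWeight c hc ℓ j : ℂ) * ((1 - (dklmAtomA c ℓ j : ℂ)) ^ (w₂' + 1) - 1) *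
            (1 - (dklmAtomA c ℓ j : ℂ)) ^ ((r₁' + (n' + 1) - a₁ - n') + k + a₂) * transferJointPhase c ℓ j ^ y₀ *
            star (transferJointPhase c ℓ j) ^ y₂ * (1 - (1 - (dklmAtomA c ℓ j : ℂ)) ^ (n' + 1))) +
          ((cylinderPairExp c r₁' (lPairObs r₁' a₁ w₁' h₁ q ((y₀ : ℕ) : ZMod (2 * (ℓ + 1)))) (r₁' + 1 + ((n' + 1) + k)) r₂' (rowBlockObs r₂' a₂ w₂' h₂ ((y₂ : ℕ) : ZMod (2 * (ℓ + 1)))) : ℝ) : ℂ) +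
          ∑ j, (dklmWeight c hc ℓ j : ℂ) * ((1 - (dklmAtomA c ℓ j : ℂ)) ^ (w₂' + 1) - 1) *
            (1 - (dklmAtomA c ℓ j : ℂ)) ^ ((r₁' + (n' + 1) - (a₁ + w₁' + 1) - n') + k + a₂) *
            transferJointPhase c ℓ j ^ (y₀ + q) * star (transferJointPhase c ℓ j) ^ y₂ *
            (1 - (1 - (dklmAtomA c ℓ j : ℂ)) ^ (n' + 1)) := by
      funext n'
      rw [hdecomp n', Complex.ofReal_add, Complex.ofReal_add, Complex.ofReal_neg, hA n', hC n']
    rw [hseq]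
    -- exponents: `r₁' + (n'+1) - a₁ - n' = r₁' + 1 - a₁` and `r₁' + (n'+1) - (a₁+w₁'+1) - n' = r₁' - a₁ - w₁'`
    have ex1 : ∀ n' : ℕ, r₁' + (n' + 1) - a₁ - n' + k + a₂ = (r₁' - a₁ - w₁') + k + a₂ + (w₁' + 1) := fun n' => by omega
    have ex2 : ∀ n' : ℕ, r₁' + (n' + 1) - (a₁ + w₁' + 1) - n' + k + a₂ = (r₁' - a₁ - w₁') + k + a₂ := fun n' => by omega
    simp only [ex1, ex2]
    -- termwise limits
    have hlimA : Tendsto (fun n' : ℕ => ∑ j, (dklmWeight c hc ℓ j : ℂ) * ((1 - (dklmAtomA c ℓ j : ℂ)) ^ (w₂' + 1) - 1) *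
        (1 - (dklmAtomA c ℓ j : ℂ)) ^ ((r₁' - a₁ - w₁') + k + a₂ + (w₁' + 1)) * transferJointPhase c ℓ j ^ y₀ *
        star (transferJointPhase c ℓ j) ^ y₂ * (1 - (1 - (dklmAtomA c ℓ j : ℂ)) ^ (n' + 1))) atTop
        (𝓝 (∑ j, (dklmWeight c hc ℓ j : ℂ) * ((1 - (dklmAtomA c ℓ j : ℂ)) ^ (w₂' + 1) - 1) *
          (1 - (dklmAtomA c ℓ j : ℂ)) ^ ((r₁' - a₁ - w₁') + k + a₂ + (w₁' + 1)) * transferJointPhase c ℓ j ^ y₀ *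
          star (transferJointPhase c ℓ j) ^ y₂ * (1 - 0))) := by
      refine tendsto_finsetSum _ fun j _ => ?_
      have hw := (tendsto_dklmWeight_mul_pow c hc ℓ j).comp (tendsto_add_atTop_nat 1)
      have h2 : Tendsto (fun n' : ℕ => (dklmWeight c hc ℓ j : ℂ) * ((1 - (dklmAtomA c ℓ j : ℂ)) ^ (w₂' + 1) - 1) *
          (1 - (dklmAtomA c ℓ j : ℂ)) ^ ((r₁' - a₁ - w₁') + k + a₂ + (w₁' + 1)) * transferJointPhase c ℓ j ^ y₀ *
          star (transferJointPhase c ℓ j) ^ y₂ -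
          ((1 - (dklmAtomA c ℓ j : ℂ)) ^ (w₂' + 1) - 1) *
          (1 - (dklmAtomA c ℓ j : ℂ)) ^ ((r₁' - a₁ - w₁') + k + a₂ + (w₁' + 1)) * transferJointPhase c ℓ j ^ y₀ *
          star (transferJointPhase c ℓ j) ^ y₂ * ((dklmWeight c hc ℓ j : ℂ) * (1 - (dklmAtomA c ℓ j : ℂ)) ^ (n' + 1)))
          atTop (𝓝 (_ - _ * 0)) := tendsto_const_nhds.sub (hw.const_mul _)
      refine (h2.congr fun n' => ?_).trans ?_
      · ring
      · rw [mul_zero, sub_zero, sub_zero, mul_one]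
    have hlimC : Tendsto (fun n' : ℕ => ∑ j, (dklmWeight c hc ℓ j : ℂ) * ((1 - (dklmAtomA c ℓ j : ℂ)) ^ (w₂' + 1) - 1) *
        (1 - (dklmAtomA c ℓ j : ℂ)) ^ ((r₁' - a₁ - w₁') + k + a₂) * transferJointPhase c ℓ j ^ (y₀ + q) *
        star (transferJointPhase c ℓ j) ^ y₂ * (1 - (1 - (dklmAtomA c ℓ j : ℂ)) ^ (n' + 1))) atTop
        (𝓝 (∑ j, (dklmWeight c hc ℓ j : ℂ) * ((1 - (dklmAtomA c ℓ j : ℂ)) ^ (w₂' + 1) - 1) *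
          (1 - (dklmAtomA c ℓ j : ℂ)) ^ ((r₁' - a₁ - w₁') + k + a₂) * transferJointPhase c ℓ j ^ (y₀ + q) *
          star (transferJointPhase c ℓ j) ^ y₂ * (1 - 0))) := by
      refine tendsto_finsetSum _ fun j _ => ?_
      have hw := (tendsto_dklmWeight_mul_pow c hc ℓ j).comp (tendsto_add_atTop_nat 1)
      have h2 : Tendsto (fun n' : ℕ => (dklmWeight c hc ℓ j : ℂ) * ((1 - (dklmAtomA c ℓ j : ℂ)) ^ (w₂' + 1) - 1) *
          (1 - (dklmAtomA c ℓ j : ℂ)) ^ ((r₁' - a₁ - w₁') + k + a₂) * transferJointPhase c ℓ j ^ (y₀ + q) *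
          star (transferJointPhase c ℓ j) ^ y₂ -
          ((1 - (dklmAtomA c ℓ j : ℂ)) ^ (w₂' + 1) - 1) *
          (1 - (dklmAtomA c ℓ j : ℂ)) ^ ((r₁' - a₁ - w₁') + k + a₂) * transferJointPhase c ℓ j ^ (y₀ + q) *
          star (transferJointPhase c ℓ j) ^ y₂ * ((dklmWeight c hc ℓ j : ℂ) * (1 - (dklmAtomA c ℓ j : ℂ)) ^ (n' + 1)))
          atTop (𝓝 (_ - _ * 0)) := tendsto_const_nhds.sub (hw.const_mul _)
      refine (h2.congr fun n' => ?_).trans ?_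
      · ring
      · rw [mul_zero, sub_zero, sub_zero, mul_one]
    have hMc : Tendsto (fun n' : ℕ => ((cylinderPairExp c r₁' (lPairObs r₁' a₁ w₁' h₁ q ((y₀ : ℕ) : ZMod (2 * (ℓ + 1)))) (r₁' + 1 + ((n' + 1) + k)) r₂' (rowBlockObs r₂' a₂ w₂' h₂ ((y₂ : ℕ) : ZMod (2 * (ℓ + 1)))) : ℝ) : ℂ)) atTop (𝓝 0) := by
      have h := (Complex.continuous_ofReal.tendsto _).comp hM
      rwa [Complex.ofReal_zero] at h
    have htot := (hlimA.neg.add hMc).add hlimC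
    convert htot using 2
    rw [add_zero, ← Finset.sum_neg_distrib, ← Finset.sum_add_distrib]
    refine Finset.sum_congr rfl fun j _ => ?_
    rw [pow_add]
    ring
  exact tendsto_nhds_unique tendsto_const_nhds hconst

end StepTwo

end Literature.Probability.LatticeModels.SixVertex

end
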